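import Summits.BirchSwinnertonDyer.Rank1Residual.X10.BeyondCarrierResidualOfTwins
import Summits.BirchSwinnertonDyer.BirchSwinnertonDyer.Theorems.PrintX10bBeyondCarrierDepthOfResidualFrames
import Summits.BirchSwinnertonDyer.BirchSwinnertonDyer.Theses.PrintX10b
import HarnessLib

/-!
# Crux `BeyondCarrierDepthX10b` (stmt-BirchSwinnertonDyer-23055, `route-BirchSwinnertonDyer-PrintX10b`
# rev 19) BY NAME from the five named facts of the Howard road AND its two new crux ITEMS BY NAME —
# r303 `HowardContainmentAnyClassNumberX10b` (stmt-BirchSwinnertonDyer-23729, A₃) and r304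
# `TwoSidedLinkAnyClassNumberX10b` (stmt-BirchSwinnertonDyer-23730, B₃): the LINE OF RECORD of the
# registered skeleton v2 as ONE kernel theorem (turnkey T-A, optional step (4))

HONEST FRAMING (cell `run/shared/lean/pub/bsd-print-x9/`, D-0131 print tier; typer seat ty3 g11 serving
the PrintX10b pen's turnkey T-A of 2026-08-27T23:24:35Z): THEOREMS ONLY, nothing booked, the crux is NOT
closed. This file is the composition of two landed theorems and adds no mathematics:
`beyondCarrierDepthX10b_of_namedFacts_of_residualFrames` (p581943, cell bsd-f3-mu lead p1: the crux from
`h46`/`hYZ`/`h331`/`hChaL`/`hKo` and the residual-frames statement `hres`) fed with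
`stub_beyondCarrier_divisibleClassNumber_of_twins_of_namedFacts` (p586853: `hres` from the twins A₃, B₃
modulo `h331`/`hChaL`/`hKo`; its hypotheses `hA`/`hB` are VERBATIM the definientia of the route items
r303/r304 of rev 19, so the items are fed BY NAME). Result: the crux's definiens
`Theses.PrintX10b.BeyondCarrierDepthX10b` GRANTED seven hypotheses — five published named facts BY NAME
(`h46` Mastella–Zerman 2026 Cor. 4.6, `hYZ` the Yan–Zhu/BCS/CGLS composite, `h331` JSW 2017 Thm. 3.3.1,
`hChaL` Cha 2005 Rmk. 25 lower half, `hKo` Kolyvagin 1990 Thm. A) and the two OPEN crux items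
`hA : Theses.PrintX10b.HowardContainmentAnyClassNumberX10b` (item 23729 = registered stub
`stub_howardContainmentAnyClassNumberX10b`: Howard containment at `p = 3`, X10b, ANY class number) and
`hB : Theses.PrintX10b.TwoSidedLinkAnyClassNumberX10b` (item 23730 = registered stub
`stub_twoSidedLinkAnyClassNumberX10b`: the two-sided IMC∘BDP link granted the containment, ANY class
number), both BEYOND PRINT at `p = 3` (cell DOSSIER §41.12–41.13). So the crux's residual of record is
exactly items 23729 ∧ 23730, in the kernel, by name. «beyond-print theorem»: NO
(conditional glue). BSD is not proved by any of this.

References: [MastellaZerman2026] Cor. 4.6; [YanZhu2024MainConjNonCM] Thm. 5.7 (1), 5.9;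
[BurungaleCastellaSkinner2025] Prop. 4.2.2; [CastellaGrossiLeeSkinner2022] Thm. 5.1.3, Thm. 4.1.1;
[JetchevSkinnerWan2017] Thm. 3.3.1; [Cha2005] Thm. 21, Rmk. 25; [Kolyvagin1990] Thm. A;
[Howard2004HeegnerKolyvagin] Thm. B; registered skeleton
`run/shared/lean/pub/bsd-print-x9/plan/skeletons/BeyondCarrierDepthX10b_birth_v2.lean`;
route file `Theses/PrintX10b.lean` (rev 19, items 21340 / 23055 / 23729 / 23730).
-/

-- the REGISTERED stub namespace `Summit.BirchSwinnertonDyer.BirchSwinnertonDyer.Cruxes.…` repeats the summit name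
set_option linter.dupNamespace false
set_option autoImplicit false

noncomputable section

open scoped Classical

open WeierstrassCurve NumberField
  Literature.NumberTheory.EllipticCurves Literature.NumberTheory.EllipticCurves.ModularForms
  Literature.NumberTheory.EllipticCurves.JetchevSkinnerWan2017
  Literature.NumberTheory.EllipticCurves.YanZhu2026
  Summit.BirchSwinnertonDyer.BirchSwinnertonDyer.Theses.PrintX10b

namespace Summit.BirchSwinnertonDyer.BirchSwinnertonDyer.Cruxes.BeyondCarrierDepthX10b.HowardFrames

/-- **Crux `BeyondCarrierDepthX10b` (item 23055) BY NAME, GRANTED the five named facts of the Howard road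
and the route's two any-class-number crux ITEMS BY NAME** — `h46` (Mastella–Zerman Cor. 4.6), `hYZ` (the
Yan–Zhu/BCS/CGLS composite), `h331` (JSW Thm. 3.3.1), `hChaL` (Cha Rmk. 25, lower half), `hKo`
(Kolyvagin Thm. A), `hA : HowardContainmentAnyClassNumberX10b` (item 23729, A₃: Howard containment at
`p = 3`, any class number) and `hB : TwoSidedLinkAnyClassNumberX10b` (item 23730, B₃: the two-sided
link granted the containment, any class number): on every rev-3b X10b Heegner frame, for every beyond-carrier depth
`s ≤ ord_3 ∏ c_q`, every derived Heegner point on Kolyvagin primes of index `≥ s` is `3^s`-divisible.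
The composition `beyondCarrierDepthX10b_of_namedFacts_of_residualFrames` (the `3 ∤ h_K` frames by
p581299 + the case split) ∘ `stub_beyondCarrier_divisibleClassNumber_of_twins_of_namedFacts` (the
`3 ∣ h_K` frames from the twins). The crux is thereby REDUCED in the kernel to A₃ ∧ B₃ modulo the
cell's named facts; it is not closed (items 23729 / 23730 open, beyond print at `p = 3`). The items are
consumed BY NAME: their definientia are literally the ∀-hypotheses of
`stub_beyondCarrier_divisibleClassNumber_of_twins_of_namedFacts` (δ-unfolding only).
[cite: MastellaZerman2026, Cor. 4.6] [cite: YanZhu2024MainConjNonCM, Thm. 5.7 (1), Thm. 5.9]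
[cite: JetchevSkinnerWan2017, Thm. 3.3.1] [cite: Cha2005, Thm. 21 and Rmk. 25] [cite: Kolyvagin1990, Thm. A]
[cite: Howard2004HeegnerKolyvagin, Thm. B (the containment, printed under p ∤ h_K)] -/
theorem beyondCarrierDepthX10b_of_namedFacts_of_twins
    (h46 : MastellaZerman2026.cor46_howardDivisibility_of_scalarImage.{0})
    (hYZ : thm57_thm59_bcs422_cgls513_generator_constantCoeff_of_heegnerDivisibility)
    (h331 : thm331_anticyclotomicControl)
    (hChaL : Cha2005.rmk25_pow_dvd_card_sha_primary_of_certificate)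
    (hKo : ∀ (N : ℕ) [NeZero N] (W : WeierstrassCurve ℚ) (K : Type) [Field K] [NumberField K],
      kolyvagin N W K)
    (hA : HowardContainmentAnyClassNumberX10b) (hB : TwoSidedLinkAnyClassNumberX10b) :
    BeyondCarrierDepthX10b :=
  beyondCarrierDepthX10b_of_namedFacts_of_residualFrames h46 hYZ h331 hChaL hKo
    (stub_beyondCarrier_divisibleClassNumber_of_twins_of_namedFacts h331 hChaL hKo hA hB)

end Summit.BirchSwinnertonDyer.BirchSwinnertonDyer.Cruxes.BeyondCarrierDepthX10b.HowardFrames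

end
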